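import Literature.Algebra.Module.PairedTorsionModulesAlternating
import Literature.Algebra.Module.TorsionHomCountingDVR
import HarnessLib

/-!
# Torsion of a decomposition `N ≅ (𝒪/𝔪^b)^ε ⊕ M ⊕ M` over a DVR: transport to `N[ϖ^a]`, element orders
versus lengths, and the invariance of `(ε, len M)`

B. Howard, *The Heegner point Kolyvagin system*, Compos. Math. 140 (2004), §1.6 (arXiv:1202.6340 §2.6): the
proofs of Lemma 1.6.3 and of the first case of Lemma 1.6.4 (arXiv p. 11 L104–117, L133–140) read a decomposition
`H¹_{F(n)}(K, T^{(k)}) ≅ R^{(k),ε} ⊕ M^{(k)}(n) ⊕ M^{(k)}(n)` (Thm. 1.4.2) through the identification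
`H¹_{F(n)}(K, T^{(i)}) ≅ H¹_{F(n)}(K, T^{(k)})[𝔪^i]` (Lemma 1.3.3): «`M^{(i)} ≅ M^{(k)}[𝔪^i] = M^{(k)}`, so that
`λ^{(i)}(n) = λ^{(k)}(n)`» and «the hypothesis `Stub^{(k)}(n) ≠ 0` implies that `len_R(M^{(2k-1)}) < k` and that
`ε = 1`».  The module algebra behind these sentences, over a DVR `𝒪` with uniformizer `ϖ`:

* §1 (any commutative ring) `R`-linear `A[a] ≅ B[a]` for `A ≅ B`, `(A × B)[a] ≅ A[a] × B[a]`, `(Π Aᵢ)[a] ≅ Π Aᵢ[a]`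
  (the tree's `PIDInvariantFactors` has these over the residue ring `R/(p)`; here over `R`, for lengths).
* §2 `(𝒪/ϖ^b)[ϖ^a] ≅ 𝒪/ϖ^a` for `a ≤ b` (`len_𝒪 (𝒪/ϖ^a) = a` is the tree's `length_quotient_uniformizer_pow`); hence the transport
  `N[ϖ^a] ≅ (𝒪/𝔪^a)^ε × (M[ϖ^a] × M[ϖ^a])` of a decomposition `N ≅ (𝒪/𝔪^b)^ε × (M × M)`.
* §3 element orders: an element of exact order `ϖ^{t+1}` embeds `𝒪/ϖ^{t+1}` into `N[ϖ^{t+1}]`; so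
  `ϖ^{len M} M = 0` (M finite) and `len M[ϖ^a] < a ⇒ ϖ^{a-1} M = 0`.
* §4 `(ε, len M)` is an invariant of `N` among decompositions `N ≅ (𝒪/𝔪^b)^ε × M²` with `ε ≤ 1`, `b ≥ 1`
  (the tree's `DVRSetting.epsilon_eq_and_length_eq_of_two_decompositions`, made generic).

Theorems only; no `sorry`. [cite: Howard2004HeegnerKolyvagin, Lemma 1.6.3 and Lemma 1.6.4 (arXiv:1202.6340 p. 11 L104–117, L133–140)]
[cite: Hungerford1974, Ch. IV Lemma 6.10 and Thm. 6.12 (PDF p. 305–307)]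
-/

set_option autoImplicit false

open Module Submodule

namespace Literature.Algebra.Module

/-! ## §1 `R`-linear transport of `torsionBy` -/

section CommRing

variable {R : Type*} [CommRing R]
  {M : Type*} [AddCommGroup M] [Module R M] {M' : Type*} [AddCommGroup M'] [Module R M']

/-- `A[a] ≅ B[a]` (`R`-linearly) for `A ≅ B`. [cite: Hungerford1974, Ch. IV Lemma 6.10 (v) (PDF p. 305)] -/
theorem nonempty_torsionBy_linearEquiv (e : M ≃ₗ[R] M') (a : R) :
    Nonempty (torsionBy R M a ≃ₗ[R] torsionBy R M' a) := by
  have hmem : ∀ x : M, x ∈ torsionBy R M a ↔ e x ∈ torsionBy R M' a := fun x => by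
    simp only [mem_torsionBy_iff, ← map_smul, e.map_eq_zero_iff]
  let f : torsionBy R M a →ₗ[R] torsionBy R M' a :=
    { toFun := fun x => ⟨e (x : M), (hmem (x : M)).1 x.2⟩
      map_add' := fun x y => Subtype.ext (map_add e (x : M) (y : M))
      map_smul' := fun c x => Subtype.ext (map_smul e c (x : M)) }
  refine ⟨LinearEquiv.ofBijective f ⟨fun x y hxy => ?_, fun y => ?_⟩⟩
  · exact Subtype.ext (e.injective (congrArg (fun z : torsionBy R M' a => (z : M')) hxy))
  · exact ⟨⟨e.symm (y : M'), (hmem _).2 (by rw [e.apply_symm_apply]; exact y.2)⟩,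
      Subtype.ext (e.apply_symm_apply (y : M'))⟩

/-- `(A × B)[a] ≅ A[a] × B[a]` (`R`-linearly). [cite: Hungerford1974, Ch. IV Lemma 6.10 (iv) (PDF p. 305)] -/
theorem nonempty_torsionBy_prod_linearEquivR (a : R) :
    Nonempty (torsionBy R (M × M') a ≃ₗ[R] torsionBy R M a × torsionBy R M' a) := by
  have hmem : ∀ x : M × M', x ∈ torsionBy R (M × M') a ↔
      x.1 ∈ torsionBy R M a ∧ x.2 ∈ torsionBy R M' a := fun x => by
    simp only [mem_torsionBy_iff, Prod.smul_def, Prod.mk_eq_zero]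
  let f : torsionBy R (M × M') a →ₗ[R] torsionBy R M a × torsionBy R M' a :=
    { toFun := fun x => (⟨x.1.1, ((hmem _).1 x.2).1⟩, ⟨x.1.2, ((hmem _).1 x.2).2⟩)
      map_add' := fun _ _ => rfl
      map_smul' := fun _ _ => rfl }
  refine ⟨LinearEquiv.ofBijective f ⟨fun x y hxy => ?_, fun y => ?_⟩⟩
  · have h1 := congrArg (fun z : torsionBy R M a × torsionBy R M' a => (z.1 : M)) hxy
    have h2 := congrArg (fun z : torsionBy R M a × torsionBy R M' a => (z.2 : M')) hxy
    exact Subtype.ext (Prod.ext h1 h2)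
  · exact ⟨⟨((y.1 : M), (y.2 : M')), (hmem _).2 ⟨y.1.2, y.2.2⟩⟩, rfl⟩

/-- `(Π Aᵢ)[a] ≅ Π Aᵢ[a]` (`R`-linearly). [cite: Hungerford1974, Ch. IV Lemma 6.10 (iv) (PDF p. 305)] -/
theorem nonempty_torsionBy_pi_linearEquivR {ι : Type*} {A : ι → Type*}
    [∀ i, AddCommGroup (A i)] [∀ i, Module R (A i)] (a : R) :
    Nonempty (torsionBy R (Π i, A i) a ≃ₗ[R] Π i, torsionBy R (A i) a) := by
  have hmem : ∀ x : Π i, A i, x ∈ torsionBy R (Π i, A i) a ↔ ∀ i, x i ∈ torsionBy R (A i) a :=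
    fun x => by simp only [mem_torsionBy_iff, funext_iff, Pi.smul_apply, Pi.zero_apply]
  let f : torsionBy R (Π i, A i) a →ₗ[R] Π i, torsionBy R (A i) a :=
    { toFun := fun x i => ⟨(x : Π i, A i) i, (hmem _).1 x.2 i⟩
      map_add' := fun _ _ => rfl
      map_smul' := fun _ _ => rfl }
  refine ⟨LinearEquiv.ofBijective f ⟨fun x y hxy => ?_, fun y => ?_⟩⟩
  · exact Subtype.ext (funext fun i => congrArg (fun z : Π i, torsionBy R (A i) a => (z i : A i)) hxy)
  · exact ⟨⟨fun i => (y i : A i), (hmem _).2 fun i => (y i).2⟩, rfl⟩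

/-- **Transport of a decomposition `N ≅ C^ε × (M × M)` to the `a`-torsion**:
`N[a] ≅ C[a]^ε × (M[a] × M[a])`. [cite: Hungerford1974, Ch. IV Lemma 6.10 (iv), (v) (PDF p. 305)] -/
theorem nonempty_torsionBy_linearEquiv_of_pi_prod_prod {N : Type*} [AddCommGroup N] [Module R N]
    {C : Type*} [AddCommGroup C] [Module R C] {ε : ℕ} (e : N ≃ₗ[R] (Fin ε → C) × (M × M)) (a : R) :
    Nonempty (torsionBy R N a ≃ₗ[R] (Fin ε → torsionBy R C a) × (torsionBy R M a × torsionBy R M a)) := by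
  obtain ⟨e₁⟩ := nonempty_torsionBy_linearEquiv e a
  obtain ⟨e₂⟩ := nonempty_torsionBy_prod_linearEquivR (M := Fin ε → C) (M' := M × M) a
  obtain ⟨e₃⟩ := nonempty_torsionBy_pi_linearEquivR (A := fun _ : Fin ε => C) a
  obtain ⟨e₄⟩ := nonempty_torsionBy_prod_linearEquivR (M := M) (M' := M) a
  exact ⟨e₁.trans (e₂.trans (e₃.prodCongr e₄))⟩

end CommRing

/-! ## §2 Cyclic modules over a DVR: `(𝒪/ϖ^b)[ϖ^a] ≅ 𝒪/ϖ^a` and `len (𝒪/ϖ^a) = a` -/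

section DVR

variable {R : Type*} [CommRing R] [IsDomain R] [IsDiscreteValuationRing R] {ϖ : R}
  {M : Type*} [AddCommGroup M] [Module R M]

/-- `𝔪^b = (ϖ^b)` for a uniformizer `ϖ`. [cite: Hungerford1974, Ch. IV Lemma 6.10 (PDF p. 305)] -/
theorem maximalIdeal_pow_eq_span_pow (hϖ : Irreducible ϖ) (b : ℕ) :
    IsLocalRing.maximalIdeal R ^ b = Ideal.span {ϖ ^ b} := by
  rw [(IsDiscreteValuationRing.irreducible_iff_uniformizer ϖ).mp hϖ, Ideal.span_singleton_pow]

/-- `len_𝒪 (𝒪/𝔪^b) = b`. [cite: Hungerford1974, Ch. IV Lemma 6.10 (i) (PDF p. 305)] -/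
theorem length_quotient_maximalIdeal_pow (hϖ : Irreducible ϖ) (b : ℕ) :
    Module.length R (R ⧸ IsLocalRing.maximalIdeal R ^ b) = b := by
  rw [(Submodule.quotEquivOfEq _ _ (maximalIdeal_pow_eq_span_pow hϖ b)).length_eq]
  exact length_quotient_uniformizer_pow hϖ b

omit [IsDiscreteValuationRing R] in
/-- **`(𝒪/ϖ^b)[ϖ^a] ≅ 𝒪/ϖ^a` for `a ≤ b`** (any domain) (the `ϖ^a`-torsion of `𝒪/ϖ^b` is `ϖ^{b-a}𝒪/ϖ^b𝒪`, cyclic with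
annihilator `(ϖ^a)`). [cite: Hungerford1974, Ch. IV Lemma 6.10 (i) (PDF p. 305)] -/
theorem nonempty_torsionBy_quotient_span_pow_linearEquiv (hϖ : Irreducible ϖ) {a b : ℕ} (hab : a ≤ b) :
    Nonempty (torsionBy R (R ⧸ Ideal.span {ϖ ^ b}) (ϖ ^ a) ≃ₗ[R] R ⧸ Ideal.span {ϖ ^ a}) := by
  have hϖ0 : ∀ n : ℕ, ϖ ^ n ≠ 0 := fun n => pow_ne_zero n hϖ.ne_zero
  -- the generator `[ϖ^{b-a}]` of the torsion
  have hgen : (Ideal.Quotient.mk (Ideal.span {ϖ ^ b}) (ϖ ^ (b - a))) ∈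
      torsionBy R (R ⧸ Ideal.span {ϖ ^ b}) (ϖ ^ a) := by
    rw [mem_torsionBy_iff, Algebra.smul_def, Ideal.Quotient.algebraMap_eq, ← map_mul,
      Ideal.Quotient.eq_zero_iff_mem, ← pow_add, Nat.add_sub_cancel' hab]
    exact Ideal.mem_span_singleton_self _
  -- the map `r ↦ r · [ϖ^{b-a}]`, `R → (R/ϖ^b)[ϖ^a]`
  let g : R →ₗ[R] torsionBy R (R ⧸ Ideal.span {ϖ ^ b}) (ϖ ^ a) :=
    LinearMap.toSpanSingleton R _ ⟨_, hgen⟩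
  -- its kernel is `(ϖ^a)`
  have hker : LinearMap.ker g = Ideal.span {ϖ ^ a} := by
    ext r
    rw [LinearMap.mem_ker, LinearMap.toSpanSingleton_apply, Subtype.ext_iff, SetLike.val_smul,
      ZeroMemClass.coe_zero, Algebra.smul_def, Ideal.Quotient.algebraMap_eq, ← map_mul,
      Ideal.Quotient.eq_zero_iff_mem, Ideal.mem_span_singleton, Ideal.mem_span_singleton]
    constructor
    · rintro ⟨c, hc⟩
      refine ⟨c, mul_right_cancel₀ (hϖ0 (b - a)) ?_⟩
      rw [hc, mul_assoc, mul_comm c, ← mul_assoc, ← pow_add, Nat.add_sub_cancel' hab]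
    · rintro ⟨c, rfl⟩
      exact ⟨c, by rw [mul_assoc, mul_comm c, ← mul_assoc, ← pow_add, Nat.add_sub_cancel' hab]⟩
  -- it is surjective: `ϖ^a x ∈ (ϖ^b)` forces `x ∈ (ϖ^{b-a})`
  have hsurj : Function.Surjective g := by
    rintro ⟨x, hx⟩
    obtain ⟨x, rfl⟩ := Ideal.Quotient.mk_surjective x
    rw [mem_torsionBy_iff, Algebra.smul_def, Ideal.Quotient.algebraMap_eq, ← map_mul,
      Ideal.Quotient.eq_zero_iff_mem, Ideal.mem_span_singleton] at hx
    obtain ⟨c, hc⟩ := hx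
    refine ⟨c, Subtype.ext ?_⟩
    rw [LinearMap.toSpanSingleton_apply, SetLike.val_smul, Algebra.smul_def, Ideal.Quotient.algebraMap_eq,
      ← map_mul]
    congr 1
    refine mul_left_cancel₀ (hϖ0 a) ?_
    rw [hc, mul_comm c, ← mul_assoc, ← pow_add, Nat.add_sub_cancel' hab]
  exact ⟨(g.quotKerEquivOfSurjective hsurj).symm.trans (Submodule.quotEquivOfEq _ _ hker)⟩

/-- `len_𝒪 ((𝒪/ϖ^b)[ϖ^a]) = a` for `a ≤ b`. [cite: Hungerford1974, Ch. IV Lemma 6.10 (i), (iii) (PDF p. 305)] -/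
theorem length_torsionBy_quotient_span_pow (hϖ : Irreducible ϖ) {a b : ℕ} (hab : a ≤ b) :
    Module.length R (torsionBy R (R ⧸ Ideal.span {ϖ ^ b}) (ϖ ^ a)) = a := by
  obtain ⟨e⟩ := nonempty_torsionBy_quotient_span_pow_linearEquiv hϖ hab
  rw [e.length_eq, length_quotient_uniformizer_pow hϖ a]

/-- `(𝒪/𝔪^b)[ϖ^a] ≅ 𝒪/𝔪^a` for `a ≤ b`. [cite: Hungerford1974, Ch. IV Lemma 6.10 (i) (PDF p. 305)] -/
theorem nonempty_torsionBy_quotient_maximalIdeal_pow_linearEquiv (hϖ : Irreducible ϖ) {a b : ℕ} (hab : a ≤ b) :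
    Nonempty (torsionBy R (R ⧸ IsLocalRing.maximalIdeal R ^ b) (ϖ ^ a) ≃ₗ[R]
      R ⧸ IsLocalRing.maximalIdeal R ^ a) := by
  obtain ⟨e₁⟩ := nonempty_torsionBy_linearEquiv
    (Submodule.quotEquivOfEq _ _ (maximalIdeal_pow_eq_span_pow hϖ b)) (ϖ ^ a)
  obtain ⟨e₂⟩ := nonempty_torsionBy_quotient_span_pow_linearEquiv hϖ hab
  exact ⟨e₁.trans (e₂.trans (Submodule.quotEquivOfEq _ _ (maximalIdeal_pow_eq_span_pow hϖ a)).symm)⟩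

/-- **Transport of a Howard decomposition to the `ϖ^a`-torsion**: from
`N ≅ (𝒪/𝔪^b)^ε × (M × M)` and `a ≤ b`, `N[ϖ^a] ≅ (𝒪/𝔪^a)^ε × (M[ϖ^a] × M[ϖ^a])` — the module algebra of
«`M^{(i)} ≅ M^{(k)}[𝔪^i]`». [cite: Howard2004HeegnerKolyvagin, Lemma 1.6.4 proof (arXiv p. 11 L135–137)]
[cite: Hungerford1974, Ch. IV Lemma 6.10 (PDF p. 305)] -/
theorem nonempty_torsionBy_linearEquiv_pi_quotient_prod_prod (hϖ : Irreducible ϖ) {N : Type*} [AddCommGroup N]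
    [Module R N] {ε a b : ℕ} (hab : a ≤ b)
    (e : N ≃ₗ[R] (Fin ε → R ⧸ IsLocalRing.maximalIdeal R ^ b) × (M × M)) :
    Nonempty (torsionBy R N (ϖ ^ a) ≃ₗ[R]
      (Fin ε → R ⧸ IsLocalRing.maximalIdeal R ^ a) × (torsionBy R M (ϖ ^ a) × torsionBy R M (ϖ ^ a))) := by
  obtain ⟨e₁⟩ := nonempty_torsionBy_linearEquiv_of_pi_prod_prod e (ϖ ^ a)
  obtain ⟨e₂⟩ := nonempty_torsionBy_quotient_maximalIdeal_pow_linearEquiv (R := R) hϖ hab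
  exact ⟨e₁.trans ((LinearEquiv.piCongrRight fun _ => e₂).prodCongr (LinearEquiv.refl R _))⟩

/-! ## §3 Element orders versus lengths -/

/-- **An element of exact order `ϖ^{t+1}` embeds `𝒪/ϖ^{t+1}` into `M[ϖ^{t+1}]`**: its annihilator is an ideal
of the DVR containing `ϖ^{t+1}` and not `ϖ^t`, hence `= (ϖ^{t+1})`.
[cite: Hungerford1974, Ch. IV Lemma 6.10 (i) and Thm. 6.12 (PDF p. 305–307)] -/
theorem exists_injective_of_exact_order (hϖ : Irreducible ϖ) {m : M} {t : ℕ}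
    (h1 : ϖ ^ (t + 1) • m = 0) (h0 : ϖ ^ t • m ≠ 0) :
    ∃ f : (R ⧸ Ideal.span {ϖ ^ (t + 1)}) →ₗ[R] torsionBy R M (ϖ ^ (t + 1)), Function.Injective f := by
  have hm : m ∈ torsionBy R M (ϖ ^ (t + 1)) := (mem_torsionBy_iff _ _).2 h1
  let g : R →ₗ[R] torsionBy R M (ϖ ^ (t + 1)) := LinearMap.toSpanSingleton R _ ⟨m, hm⟩
  -- `ker g = Ann(m) = (ϖ^{t+1})`
  have hker : LinearMap.ker g = Ideal.span {ϖ ^ (t + 1)} := by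
    have hne : LinearMap.ker g ≠ ⊥ := by
      intro h
      have : ϖ ^ (t + 1) ∈ LinearMap.ker g := by
        rw [LinearMap.mem_ker, LinearMap.toSpanSingleton_apply]
        exact Subtype.ext h1
      rw [h, Submodule.mem_bot] at this
      exact pow_ne_zero _ hϖ.ne_zero this
    obtain ⟨n, hn⟩ := IsDiscreteValuationRing.ideal_eq_span_pow_irreducible hne hϖ
    have hmem : ∀ s : ℕ, ϖ ^ s ∈ LinearMap.ker g ↔ ϖ ^ s • m = 0 := fun s => by
      rw [LinearMap.mem_ker, LinearMap.toSpanSingleton_apply, Subtype.ext_iff]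
      rfl
    have h1' : n ≤ t + 1 := by
      have := (hmem (t + 1)).2 h1
      rw [hn, Ideal.mem_span_singleton, pow_dvd_pow_iff hϖ.ne_zero hϖ.not_isUnit] at this
      exact this
    have h0' : ¬ n ≤ t := fun hle => by
      have : ϖ ^ t ∈ LinearMap.ker g := by
        rw [hn, Ideal.mem_span_singleton]
        exact pow_dvd_pow ϖ hle
      exact h0 ((hmem t).1 this)
    rw [hn, show n = t + 1 by omega]
  refine ⟨(Ideal.span {ϖ ^ (t + 1)}).liftQ g (le_of_eq hker.symm), ?_⟩
  rw [← LinearMap.ker_eq_bot]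
  exact Submodule.ker_liftQ_eq_bot' _ _ hker.symm

/-- … hence `t + 1 ≤ len M[ϖ^{t+1}]` for an element of exact order `ϖ^{t+1}`.
[cite: Hungerford1974, Ch. IV Lemma 6.10 (i) and Thm. 6.12 (PDF p. 305–307)] -/
theorem succ_le_length_torsionBy_of_exact_order (hϖ : Irreducible ϖ) {m : M} {t : ℕ}
    (h1 : ϖ ^ (t + 1) • m = 0) (h0 : ϖ ^ t • m ≠ 0) :
    ((t + 1 : ℕ) : ℕ∞) ≤ Module.length R (torsionBy R M (ϖ ^ (t + 1))) := by
  obtain ⟨f, hf⟩ := exists_injective_of_exact_order hϖ h1 h0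
  rw [← length_quotient_uniformizer_pow hϖ (t + 1)]
  exact Module.length_le_of_injective f hf

/-- **Every element of a FINITE module over a DVR is killed by a power of `ϖ`** (two powers `ϖ^i m = ϖ^j m`
coincide and `1 - ϖ^{j-i}` is a unit). [cite: Hungerford1974, Ch. IV Thm. 6.12 (PDF p. 307)] -/
theorem exists_pow_smul_eq_zero_of_finite (hϖ : Irreducible ϖ) [Finite M] (m : M) :
    ∃ i : ℕ, ϖ ^ i • m = 0 := by
  obtain ⟨i, j, hij, heq⟩ := Finite.exists_ne_map_eq_of_infinite (fun n : ℕ => ϖ ^ n • m)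
  wlog hlt : i < j generalizing i j
  · exact this j i hij.symm heq.symm (lt_of_le_of_ne (not_lt.mp hlt) hij.symm)
  refine ⟨i, ?_⟩
  obtain ⟨d, rfl⟩ := Nat.exists_eq_add_of_lt hlt
  have hu : IsUnit (1 - ϖ ^ (d + 1)) := by
    apply IsLocalRing.isUnit_one_sub_self_of_mem_nonunits
    rw [← IsLocalRing.mem_maximalIdeal]
    exact Ideal.pow_mem_of_mem _ ((IsDiscreteValuationRing.irreducible_iff_uniformizer ϖ).mp hϖ ▸
      Ideal.mem_span_singleton_self ϖ) _ (Nat.succ_pos d)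
  have h2 : (1 - ϖ ^ (d + 1)) • (ϖ ^ i • m) = 0 := by
    rw [sub_smul, one_smul, ← mul_smul, ← pow_add, add_comm (d + 1) i, ← add_assoc]
    exact sub_eq_zero.mpr (heq : ϖ ^ i • m = ϖ ^ (i + d + 1) • m)
  exact (hu.smul_eq_zero).mp h2 |> fun h => by simpa using h

/-- **`len M[ϖ^a] < a ⇒ ϖ^{a-1} M = 0`** (for a `ϖ`-power torsion module: an element not killed by `ϖ^{a-1}`
has a multiple of exact order `ϖ^a`, embedding `𝒪/ϖ^a`, of length `a`, into `M[ϖ^a]`) — the algebra of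
«`Stub^{(k)}(n) ≠ 0` implies `len_R(M^{(2k-1)}) < k`» read backwards on elementary divisors.
[cite: Howard2004HeegnerKolyvagin, Lemma 1.6.3 proof (arXiv p. 11 L113–117)] [cite: Hungerford1974, Ch. IV Thm. 6.12 (PDF p. 307)] -/
theorem pow_pred_smul_eq_zero_of_length_torsionBy_lt (hϖ : Irreducible ϖ)
    (htors : ∀ m : M, ∃ i : ℕ, ϖ ^ i • m = 0) {a : ℕ}
    (hlt : Module.length R (torsionBy R M (ϖ ^ a)) < a) (m : M) : ϖ ^ (a - 1) • m = 0 := by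
  classical
  by_contra h0
  have ha : 1 ≤ a := by
    rcases Nat.eq_zero_or_pos a with rfl | h
    · exact absurd hlt (by simp)
    · exact h
  let b := Nat.find (htors m)
  have hb : ϖ ^ b • m = 0 := Nat.find_spec (htors m)
  have hab : a ≤ b := by
    by_contra hlt'
    apply h0
    have : a - 1 = b + (a - 1 - b) := by omega
    rw [this, pow_add, mul_comm, mul_smul, hb, smul_zero]
  -- `m₁ = ϖ^{b-a} m` has exact order `ϖ^a`
  have h1 : ϖ ^ (a - 1 + 1) • (ϖ ^ (b - a) • m) = 0 := by
    rw [← mul_smul, ← pow_add, show a - 1 + 1 + (b - a) = b by omega, hb]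
  have h0' : ϖ ^ (a - 1) • (ϖ ^ (b - a) • m) ≠ 0 := by
    rw [← mul_smul, ← pow_add, show a - 1 + (b - a) = b - 1 by omega]
    have := Nat.find_min (htors m) (show b - 1 < b by omega)
    exact this
  have hle := succ_le_length_torsionBy_of_exact_order hϖ h1 h0'
  rw [show a - 1 + 1 = a by omega] at hle
  exact absurd (lt_of_le_of_lt hle hlt) (lt_irrefl _)

/-- **`ϖ^{len M} · M = 0` for a finite `𝒪`-module `M`** (an element of order `> len M` would embed a cyclic
module of length `len M + 1`) — «`M^{(k)}[𝔪^i] = M^{(k)}` for `i = len M^{(k)}`».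
[cite: Howard2004HeegnerKolyvagin, Lemma 1.6.4 proof (arXiv p. 11 L135–137)] [cite: Hungerford1974, Ch. IV Thm. 6.12 (PDF p. 307)] -/
theorem pow_length_smul_eq_zero (hϖ : Irreducible ϖ) [Finite M] (m : M) :
    ϖ ^ (Module.length R M).toNat • m = 0 := by
  classical
  haveI : IsArtinian R M := isArtinian_of_finite
  haveI : IsNoetherian R M := isNoetherian_of_finite R M
  set L := (Module.length R M).toNat with hL
  have hLlen : Module.length R M = L := (ENat.coe_toNat (Module.length_ne_top (R := R) (M := M))).symm
  by_contra h0
  let b := Nat.find (exists_pow_smul_eq_zero_of_finite hϖ m)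
  have hb : ϖ ^ b • m = 0 := Nat.find_spec (exists_pow_smul_eq_zero_of_finite hϖ m)
  have hLb : L + 1 ≤ b := by
    by_contra hlt
    apply h0
    rw [show L = b + (L - b) by omega, pow_add, mul_comm, mul_smul, hb, smul_zero]
  have h1 : ϖ ^ (L + 1) • (ϖ ^ (b - (L + 1)) • m) = 0 := by
    rw [← mul_smul, ← pow_add, show L + 1 + (b - (L + 1)) = b by omega, hb]
  have h0' : ϖ ^ L • (ϖ ^ (b - (L + 1)) • m) ≠ 0 := by
    rw [← mul_smul, ← pow_add, show L + (b - (L + 1)) = b - 1 by omega]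
    exact Nat.find_min (exists_pow_smul_eq_zero_of_finite hϖ m) (show b - 1 < b by omega)
  have hle := (succ_le_length_torsionBy_of_exact_order hϖ h1 h0').trans
    (Module.length_le_of_injective (torsionBy R M (ϖ ^ (L + 1))).subtype (Submodule.subtype_injective _))
  rw [hLlen, Nat.cast_le] at hle
  omega

omit [IsDomain R] [IsDiscreteValuationRing R] in
/-- `M[ϖ^a] = M` (the torsion submodule is everything) as soon as `ϖ^a` kills `M`; in particular for
`a = len M`. [cite: Hungerford1974, Ch. IV Lemma 6.10 (PDF p. 305)] -/
theorem torsionBy_eq_top_of_forall_smul_eq_zero {a : R} (h : ∀ m : M, a • m = 0) :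
    torsionBy R M a = ⊤ :=
  eq_top_iff.mpr fun m _ => (mem_torsionBy_iff _ _).2 (h m)

omit [IsDomain R] [IsDiscreteValuationRing R] in
/-- `len M[ϖ^a] = len M` as soon as `ϖ^a` kills `M`. [cite: Hungerford1974, Ch. IV Lemma 6.10 (PDF p. 305)] -/
theorem length_torsionBy_eq_of_forall_smul_eq_zero {a : R} (h : ∀ m : M, a • m = 0) :
    Module.length R (torsionBy R M a) = Module.length R M := by
  rw [torsionBy_eq_top_of_forall_smul_eq_zero h]
  exact Submodule.topEquiv.length_eq

/-! ## §4 `(ε, len M)` is an invariant of the decomposed module -/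

/-- **Two decompositions `N ≅ (𝒪/𝔪^b)^{ε_i} × (M_i × M_i)` (`ε_i ≤ 1`, `b ≥ 1`, `M_i` finite) have `ε_1 = ε_2` and
`len M_1 = len M_2`** (Prop. 1.5.5's count `ε + 2 dim M[𝔪] = dim N[𝔪]` fixes `ε`; additivity of length fixes
`len M`) — the tree's `DVRSetting.epsilon_eq_and_length_eq_of_two_decompositions`, generic.
[cite: Howard2004HeegnerKolyvagin, Prop. 1.5.5 and Def. 1.5.4 (arXiv p. 10 L56–75)] -/
theorem epsilon_eq_and_length_eq_of_linearEquiv (hϖ : Irreducible ϖ) {N : Type*} [AddCommGroup N] [Module R N]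
    {b : ℕ} (hb : 1 ≤ b) {ε₁ ε₂ : ℕ} (hε₁ : ε₁ ≤ 1) (hε₂ : ε₂ ≤ 1)
    {M₁ : Type*} [AddCommGroup M₁] [Module R M₁] [Finite M₁]
    {M₂ : Type*} [AddCommGroup M₂] [Module R M₂] [Finite M₂]
    (e₁ : N ≃ₗ[R] (Fin ε₁ → R ⧸ IsLocalRing.maximalIdeal R ^ b) × (M₁ × M₁))
    (e₂ : N ≃ₗ[R] (Fin ε₂ → R ⧸ IsLocalRing.maximalIdeal R ^ b) × (M₂ × M₂)) :
    ε₁ = ε₂ ∧ Module.length R M₁ = Module.length R M₂ := by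
  have hC := finrank_torsionBy_quotient_maximalIdeal_pow hϖ hb
  have hε : ε₁ = ε₂ :=
    eq_of_linearEquiv_pi_prod_prod_self_of_torsionBy_linearEquiv hϖ hε₁ hε₂ hC hC e₁ e₂ (LinearEquiv.refl R _)
  refine ⟨hε, ?_⟩
  subst hε
  haveI : IsArtinian R M₁ := isArtinian_of_finite
  haveI : IsArtinian R M₂ := isArtinian_of_finite
  haveI : IsNoetherian R M₁ := isNoetherian_of_finite R M₁
  haveI : IsNoetherian R M₂ := isNoetherian_of_finite R M₂
  have h := (e₁.symm.trans e₂).length_eq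
  rw [Module.length_prod, Module.length_prod, Module.length_prod, Module.length_prod,
    Module.length_pi_of_fintype, Finset.sum_const, Finset.card_univ, Fintype.card_fin,
    length_quotient_maximalIdeal_pow hϖ b, ← ENat.coe_toNat (Module.length_ne_top (R := R) (M := M₁)),
    ← ENat.coe_toNat (Module.length_ne_top (R := R) (M := M₂))] at h
  have h' : ε₁ * b + ((Module.length R M₁).toNat + (Module.length R M₁).toNat) =
      ε₁ * b + ((Module.length R M₂).toNat + (Module.length R M₂).toNat) := by
    have h1 : ((ε₁ • (b : ℕ∞)) : ℕ∞) = ((ε₁ * b : ℕ) : ℕ∞) := by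
      rw [nsmul_eq_mul]; push_cast; rfl
    rw [h1] at h
    exact_mod_cast h
  rw [← ENat.coe_toNat (Module.length_ne_top (R := R) (M := M₁)),
    ← ENat.coe_toNat (Module.length_ne_top (R := R) (M := M₂))]
  congr 1
  omega

end DVR

end Literature.Algebra.Module
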